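import Mathlib.LinearAlgebra.Matrix.Charpoly.Coeff
import Mathlib.LinearAlgebra.Matrix.ToLinearEquiv
import Mathlib.LinearAlgebra.Matrix.DotProduct
import Mathlib.Algebra.Polynomial.Div
import Mathlib.Algebra.Polynomial.Inductions
import HarnessLib

/-!
# A canonical kernel vector of a singular matrix from its characteristic polynomial

Topic `Literature/LinearAlgebra` (namespace `Literature.LinearAlgebra`). Definitions with bodies and
theorems only (no named fact; D-0026). Written for the val-lit cell's KV20 roster (x5 g6; step (P5)
of the M1 programme `HOME/np/MEMO-x5g6-KV20-M1-programme.md` behind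
`Literature.Computability.AlgebraicComplexity.kumarVolk2020_cor_1_3`): the printed proof of
Kumar–Volk's Cor. 1.3 finds the equation `Q_n` "by solving a linear system of equations … using
standard, small space algorithm for linear algebra [BvzGH82, ABO99]" (arXiv:2003.12938 §5,
p0009:L2). In polynomial SPACE over an exponential-dimensional system one may only quantify over
INDICES, never over index SETS, so the textbook NULLSPACE route through a maximal nonsingular minor
([BvzGH82] §5, p0027:L7–L30) is unavailable; what is available is iterated matrix powering, hence the
characteristic polynomial. [BvzGH82] (§4, p0012:L46–66) splits `c(A) = det(A − tI)` at `t = 0`: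
"`rank_alg(A) = max{i : c_{n-i}(A) ≠ 0} = n − order of c(A) = n − multiplicity of eigenvalue 0 in
c(A)`". This file turns that splitting into an EXPLICIT nonzero kernel vector, by Cayley–Hamilton
(Mathlib `Matrix.aeval_self_charpoly`):

* `charpolyZeroMult B = k` := the multiplicity of the root `0` of `χ_B`, `charpolyUnitPart B = q` :=
  `χ_B / X^k` (so `χ_B = X^k · q`, `q(0) ≠ 0`: `X_pow_mul_charpolyUnitPart`,
  `coeff_zero_charpolyUnitPart_ne_zero`);
* `aeval_charpolyUnitPart_mul_pow`: `q(B) · B^k = 0` (Cayley–Hamilton); `aeval_charpolyUnitPart_ne_zero`: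
  `q(B) ≠ 0` as soon as `det B = 0` (over a domain: `q(B) = 0` would make `B` invertible);
* `charpolyNilIndex B = j₀` := the least `j` with `q(B) · B^j = 0` (`1 ≤ j₀ ≤ k` when `det B = 0`),
  `charpolyKernelMatrix B := q(B) · B^{j₀ − 1}` — nonzero with `B · charpolyKernelMatrix B = 0`
  (`charpolyKernelMatrix_ne_zero`, `mul_charpolyKernelMatrix`), so EVERY column of it is a kernel
  vector and SOME column is nonzero (`mulVec_charpolyKernelMatrix_col`,
  `exists_charpolyKernelMatrix_col_ne_zero`) — ★ `exists_kernelVector_of_det_eq_zero`;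
* `charpolyKernelVector B := the least nonzero column of N_B` (indices linearly ordered): `≠ 0` and
  in the kernel for singular `B` (`charpolyKernelVector_ne_zero`, `mulVec_charpolyKernelVector`);
* the Gram reduction for a rectangular integer/ordered-ring matrix `A`: `(AᵀA) v = 0 ⇒ A v = 0`
  (`mulVec_eq_zero_of_gram_mulVec_eq_zero`) and `det (AᵀA) = 0` when `A` has a nonzero kernel vector
  (`det_gram_eq_zero`), whence ★ `exists_gram_kernelVector` / ★ `charpolyKernelVector_gram_spec`:
  `charpolyKernelVector (AᵀA)` is a nonzero kernel vector of `A`.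

Every object is a polynomial in the matrix selected by least-index searches — the shape a
polynomial-space transducer can evaluate entrywise (iterated products; the searches over `j` and over
the column index are over polynomially many bits). Honest framing (val-lit): elementary linear
algebra in service of a bookkeeping reduction; nothing here bears on `VP ≠ VNP`, which is NOT proved.

## References

* [BorodinVonzurgathenHopcroft1982] A. Borodin, J. von zur Gathen, J. Hopcroft, *Fast parallel
  matrix and GCD computations*, Inform. and Control 52 (1982) 241–256, §4 (p0012:L46–66: `rank_alg`
  and the order of `c(A)` at `0`) and §5 (p0026:L34–p0027:L30: the problems EQUATIONS / NULLSPACE).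
* [KumarVolk2022] M. Kumar, B. L. Volk, ACM TOCT 14(2) (2022) = arXiv:2003.12938, §6 (= arXiv §5,
  p0009:L1–3).
-/

namespace Literature.LinearAlgebra

open Polynomial Matrix

variable {R : Type*} [CommRing R] {n : Type*} [Fintype n] [DecidableEq n]

/-! ### The splitting `χ_B = X^k · q`, `q(0) ≠ 0` -/

/-- `k_B`: the multiplicity of `0` as a root of the characteristic polynomial ("the order of `c(A)`",
`n − rank_alg(A)`). [cite: BorodinVonzurgathenHopcroft1982, §4 (p0012:L46–66)] -/
noncomputable def charpolyZeroMult (B : Matrix n n R) : ℕ := B.charpoly.rootMultiplicity 0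

/-- `q_B := χ_B / X^{k_B}`, the part of the characteristic polynomial prime to `X`.
[cite: BorodinVonzurgathenHopcroft1982, §4 (p0012:L46–66)] -/
noncomputable def charpolyUnitPart (B : Matrix n n R) : R[X] :=
  B.charpoly /ₘ (X - C 0) ^ charpolyZeroMult B

/-- `X^{k_B} · q_B = χ_B`. [cite: BorodinVonzurgathenHopcroft1982, §4 (p0012:L46–66)] -/
theorem X_pow_mul_charpolyUnitPart (B : Matrix n n R) :
    (X - C 0) ^ charpolyZeroMult B * charpolyUnitPart B = B.charpoly :=
  pow_mul_divByMonic_rootMultiplicity_eq _ _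

/-- `q_B(0) ≠ 0`. [cite: BorodinVonzurgathenHopcroft1982, §4 (p0012:L46–66)] -/
theorem coeff_zero_charpolyUnitPart_ne_zero [Nontrivial R] (B : Matrix n n R) :
    (charpolyUnitPart B).coeff 0 ≠ 0 := by
  rw [coeff_zero_eq_eval_zero]
  exact eval_divByMonic_pow_rootMultiplicity_ne_zero 0 B.charpoly_monic.ne_zero

/-- Polynomials in `B` commute with powers of `B`: `p(B) · B^j = B^j · p(B)`. [folklore] -/
private theorem aeval_mul_pow_comm (B : Matrix n n R) (p : R[X]) (j : ℕ) :
    aeval B p * B ^ j = B ^ j * aeval B p := by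
  have hX : (B : Matrix n n R) ^ j = aeval B (X ^ j : R[X]) := by rw [map_pow, aeval_X]
  rw [hX, ← map_mul, ← map_mul, mul_comm]

/-- **Cayley–Hamilton, split at `0`**: `q_B(B) · B^{k_B} = 0`.
[cite: BorodinVonzurgathenHopcroft1982, §4 (p0012:L46–66; proof: Cayley–Hamilton)] -/
theorem aeval_charpolyUnitPart_mul_pow (B : Matrix n n R) :
    aeval B (charpolyUnitPart B) * B ^ charpolyZeroMult B = 0 := by
  have h := congrArg (aeval B) (X_pow_mul_charpolyUnitPart B)
  rw [aeval_self_charpoly, map_mul, map_pow, map_sub, aeval_X, aeval_C, map_zero, sub_zero] at h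
  rw [aeval_mul_pow_comm]
  exact h

/-- **`q_B(B) ≠ 0` for a singular `B`** (over a domain, `n ≠ ∅`): if `q_B(B) = 0` then, writing
`q_B = c + X·r` with `c = q_B(0) ≠ 0`, `B · (−r(B)) = c · 1`, so `det B · det(−r(B)) = c^n ≠ 0`.
[cite: BorodinVonzurgathenHopcroft1982, §4 (p0012:L56–66: "rank(A) = n − dim(nullspace of A) … rank_alg(A) = n − multiplicity of eigenvalue 0")] -/
theorem aeval_charpolyUnitPart_ne_zero [IsDomain R] [Nonempty n] (B : Matrix n n R)
    (hB : B.det = 0) : aeval B (charpolyUnitPart B) ≠ 0 := by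
  intro h0
  have hq := congrArg (aeval B) (X_mul_divX_add (charpolyUnitPart B))
  rw [h0, map_add, map_mul, aeval_X, aeval_C, Algebra.algebraMap_eq_smul_one] at hq
  have e : B * (-aeval B (charpolyUnitPart B).divX) =
      (charpolyUnitPart B).coeff 0 • (1 : Matrix n n R) := by
    rw [mul_neg]
    exact neg_eq_iff_add_eq_zero.2 hq
  have hdet := congrArg Matrix.det e
  rw [det_mul, hB, zero_mul, det_smul, det_one, mul_one] at hdet
  exact coeff_zero_charpolyUnitPart_ne_zero B ((pow_eq_zero_iff Fintype.card_ne_zero).1 hdet.symm)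

/-! ### The nilpotency index and the kernel matrix -/

/-- Some power works: `∃ j, q_B(B) · B^j = 0` (`j = k_B`). [cite: BorodinVonzurgathenHopcroft1982, §4 (p0012:L46–66)] -/
theorem exists_aeval_charpolyUnitPart_mul_pow_eq_zero (B : Matrix n n R) :
    ∃ j : ℕ, aeval B (charpolyUnitPart B) * B ^ j = 0 :=
  ⟨_, aeval_charpolyUnitPart_mul_pow B⟩

open Classical in
/-- `j₀(B)`: the least `j` with `q_B(B) · B^j = 0`. [cite: BorodinVonzurgathenHopcroft1982, §4 (p0012:L46–66)] -/
noncomputable def charpolyNilIndex (B : Matrix n n R) : ℕ :=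
  Nat.find (exists_aeval_charpolyUnitPart_mul_pow_eq_zero B)

open Classical in
/-- `q_B(B) · B^{j₀} = 0`. [cite: BorodinVonzurgathenHopcroft1982, §4 (p0012:L46–66)] -/
theorem charpolyNilIndex_spec (B : Matrix n n R) :
    aeval B (charpolyUnitPart B) * B ^ charpolyNilIndex B = 0 :=
  Nat.find_spec (exists_aeval_charpolyUnitPart_mul_pow_eq_zero B)

open Classical in
/-- Minimality: `q_B(B) · B^j ≠ 0` for `j < j₀`. [cite: BorodinVonzurgathenHopcroft1982, §4 (p0012:L46–66)] -/
theorem charpolyNilIndex_min (B : Matrix n n R) {j : ℕ} (hj : j < charpolyNilIndex B) :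
    aeval B (charpolyUnitPart B) * B ^ j ≠ 0 :=
  Nat.find_min (exists_aeval_charpolyUnitPart_mul_pow_eq_zero B) hj

open Classical in
/-- `j₀ ≤ k_B`. [cite: BorodinVonzurgathenHopcroft1982, §4 (p0012:L46–66)] -/
theorem charpolyNilIndex_le (B : Matrix n n R) : charpolyNilIndex B ≤ charpolyZeroMult B :=
  Nat.find_min' _ (aeval_charpolyUnitPart_mul_pow B)

/-- `1 ≤ j₀` for a singular matrix over a domain. [cite: BorodinVonzurgathenHopcroft1982, §4 (p0012:L56–66)] -/
theorem charpolyNilIndex_pos [IsDomain R] [Nonempty n] (B : Matrix n n R) (hB : B.det = 0) :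
    0 < charpolyNilIndex B := by
  by_contra h
  have h0 : charpolyNilIndex B = 0 := Nat.eq_zero_of_not_pos h
  have := charpolyNilIndex_spec B
  rw [h0, pow_zero, mul_one] at this
  exact aeval_charpolyUnitPart_ne_zero B hB this

/-- **The kernel matrix** `N_B := q_B(B) · B^{j₀ − 1}`. [cite: BorodinVonzurgathenHopcroft1982, §4 p0012:L46–66 and §5 p0026:L36–37 "NULLSPACE"] -/
noncomputable def charpolyKernelMatrix (B : Matrix n n R) : Matrix n n R :=
  aeval B (charpolyUnitPart B) * B ^ (charpolyNilIndex B - 1)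

/-- **`B · N_B = 0`** for a singular `B` over a domain: the columns of `N_B` lie in the kernel of `B`.
[cite: BorodinVonzurgathenHopcroft1982, §5 (p0026:L36–37 "NULLSPACE")] -/
theorem mul_charpolyKernelMatrix [IsDomain R] [Nonempty n] (B : Matrix n n R) (hB : B.det = 0) :
    B * charpolyKernelMatrix B = 0 := by
  have hj : charpolyNilIndex B - 1 + 1 = charpolyNilIndex B :=
    Nat.sub_add_cancel (charpolyNilIndex_pos B hB)
  have hcomm : B * aeval B (charpolyUnitPart B) = aeval B (charpolyUnitPart B) * B := by
    have := aeval_mul_pow_comm B (charpolyUnitPart B) 1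
    rw [pow_one] at this
    exact this.symm
  unfold charpolyKernelMatrix
  rw [← mul_assoc, hcomm, mul_assoc, ← pow_succ', hj]
  exact charpolyNilIndex_spec B

/-- **`N_B ≠ 0`** for a singular `B` over a domain (minimality of `j₀`).
[cite: BorodinVonzurgathenHopcroft1982, §5 (p0026:L36–37 "NULLSPACE")] -/
theorem charpolyKernelMatrix_ne_zero [IsDomain R] [Nonempty n] (B : Matrix n n R)
    (hB : B.det = 0) : charpolyKernelMatrix B ≠ 0 :=
  charpolyNilIndex_min B (Nat.sub_lt (charpolyNilIndex_pos B hB) Nat.one_pos)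

omit [DecidableEq n] in
/-- Column `c` of `N_B` as a vector is `N_Bᵀ c`, and `B · (column c) = column c of B · N_B`. [folklore] -/
private theorem mulVec_transpose_apply (B N : Matrix n n R) (c : n) :
    B *ᵥ (Nᵀ c) = (B * N)ᵀ c := by
  funext r
  simp only [mulVec, dotProduct, transpose_apply, mul_apply]

/-- **Every column of `N_B` is a kernel vector**: `B · (N_Bᵀ c) = 0`.
[cite: BorodinVonzurgathenHopcroft1982, §5 (p0026:L36–37 "NULLSPACE")] -/
theorem mulVec_charpolyKernelMatrix_col [IsDomain R] [Nonempty n] (B : Matrix n n R)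
    (hB : B.det = 0) (c : n) : B *ᵥ ((charpolyKernelMatrix B)ᵀ c) = 0 := by
  rw [mulVec_transpose_apply, mul_charpolyKernelMatrix B hB]
  rfl

/-- **Some column of `N_B` is nonzero.** [cite: BorodinVonzurgathenHopcroft1982, §5 (p0026:L36–37 "NULLSPACE")] -/
theorem exists_charpolyKernelMatrix_col_ne_zero [IsDomain R] [Nonempty n] (B : Matrix n n R)
    (hB : B.det = 0) : ∃ c : n, (charpolyKernelMatrix B)ᵀ c ≠ 0 := by
  by_contra h
  push Not at h
  exact charpolyKernelMatrix_ne_zero B hB (Matrix.ext fun r c => congrFun (h c) r)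

/-- ★ **A canonical nonzero kernel vector of a singular matrix**: for `det B = 0` (domain, `n ≠ ∅`),
some column `N_Bᵀ c` of the kernel matrix `N_B = q_B(B) · B^{j₀−1}` is nonzero, and every column
satisfies `B · (N_Bᵀ c) = 0`. [cite: BorodinVonzurgathenHopcroft1982, §4 p0012:L46–66 and §5 p0026:L36–37] -/
theorem exists_kernelVector_of_det_eq_zero [IsDomain R] [Nonempty n] (B : Matrix n n R)
    (hB : B.det = 0) :
    ∃ c : n, (charpolyKernelMatrix B)ᵀ c ≠ 0 ∧ B *ᵥ ((charpolyKernelMatrix B)ᵀ c) = 0 := by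
  obtain ⟨c, hc⟩ := exists_charpolyKernelMatrix_col_ne_zero B hB
  exact ⟨c, hc, mulVec_charpolyKernelMatrix_col B hB c⟩

/-! ### The canonical kernel vector (least nonzero column) -/

section Canonical

variable [LinearOrder n]

open Classical in
/-- **The canonical kernel vector** `v_B`: the least (for the index order) nonzero column of the
kernel matrix `N_B`, and `0` if `N_B = 0` (which does not happen for a singular `B` over a domain).
[cite: BorodinVonzurgathenHopcroft1982, §5 (p0026:L36–37 "NULLSPACE (= computing a basis for the nullspace of a matrix)")] -/
noncomputable def charpolyKernelVector (B : Matrix n n R) : n → R :=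
  if h : (Finset.univ.filter fun c => (charpolyKernelMatrix B)ᵀ c ≠ 0).Nonempty then
    (charpolyKernelMatrix B)ᵀ ((Finset.univ.filter fun c => (charpolyKernelMatrix B)ᵀ c ≠ 0).min' h)
  else 0

/-- `v_B` is a column of `N_B` (or `0`). [cite: BorodinVonzurgathenHopcroft1982, §5 (p0026:L36–37)] -/
theorem charpolyKernelVector_eq_col_or_zero (B : Matrix n n R) :
    (∃ c : n, charpolyKernelVector B = (charpolyKernelMatrix B)ᵀ c) ∨ charpolyKernelVector B = 0 := by
  classical
  unfold charpolyKernelVector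
  split_ifs with h
  · exact Or.inl ⟨_, rfl⟩
  · exact Or.inr rfl

/-- **`v_B ≠ 0`** for a singular `B` over a domain. [cite: BorodinVonzurgathenHopcroft1982, §5 (p0026:L36–37)] -/
theorem charpolyKernelVector_ne_zero [IsDomain R] [Nonempty n] (B : Matrix n n R)
    (hB : B.det = 0) : charpolyKernelVector B ≠ 0 := by
  classical
  obtain ⟨c, hc⟩ := exists_charpolyKernelMatrix_col_ne_zero B hB
  have hne : (Finset.univ.filter fun c => (charpolyKernelMatrix B)ᵀ c ≠ 0).Nonempty :=
    ⟨c, Finset.mem_filter.2 ⟨Finset.mem_univ _, hc⟩⟩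
  unfold charpolyKernelVector
  rw [dif_pos hne]
  exact (Finset.mem_filter.1 (Finset.min'_mem _ hne)).2

/-- **`B · v_B = 0`** for a singular `B` over a domain. [cite: BorodinVonzurgathenHopcroft1982, §5 (p0026:L36–37)] -/
theorem mulVec_charpolyKernelVector [IsDomain R] [Nonempty n] (B : Matrix n n R)
    (hB : B.det = 0) : B *ᵥ charpolyKernelVector B = 0 := by
  rcases charpolyKernelVector_eq_col_or_zero B with ⟨c, hc⟩ | h0
  · rw [hc]; exact mulVec_charpolyKernelMatrix_col B hB c
  · rw [h0, mulVec_zero]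

end Canonical

/-! ### Rectangular systems through the Gram matrix `AᵀA` -/

section Gram

variable {S : Type*} [CommRing S] [LinearOrder S] [IsStrictOrderedRing S] {m : Type*} [Fintype m]

omit [DecidableEq n] in
/-- Over an ordered ring (e.g. `ℤ`, `ℚ`): `(AᵀA) v = 0 ⇒ A v = 0` (`|Av|² = vᵀAᵀAv`).
[cite: BorodinVonzurgathenHopcroft1982, §5 (p0026:L34–37 "EQUATIONS … NULLSPACE")] -/
theorem mulVec_eq_zero_of_gram_mulVec_eq_zero (A : Matrix m n S) (v : n → S)
    (h : (Aᵀ * A) *ᵥ v = 0) : A *ᵥ v = 0 := by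
  have h' : v ⬝ᵥ ((Aᵀ * A) *ᵥ v) = 0 := by rw [h, dotProduct_zero]
  rw [← mulVec_mulVec, dotProduct_mulVec, vecMul_transpose] at h'
  exact dotProduct_self_eq_zero.1 h'

/-- If `A` has a nonzero kernel vector then `det (AᵀA) = 0`.
[cite: BorodinVonzurgathenHopcroft1982, §5 (p0026:L34–37)] -/
theorem det_gram_eq_zero (A : Matrix m n S) {v : n → S} (hv : v ≠ 0)
    (hAv : A *ᵥ v = 0) : (Aᵀ * A).det = 0 :=
  exists_mulVec_eq_zero_iff.1 ⟨v, hv, by rw [← mulVec_mulVec, hAv, mulVec_zero]⟩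

/-- ★ **Kernel vector of a rectangular matrix via the Gram matrix**: if `A` (over an ordered domain,
e.g. `ℤ`) has some nonzero kernel vector, then with `B = AᵀA` some column `N_Bᵀ c` of
`charpolyKernelMatrix B` is nonzero and EVERY column satisfies `A · (N_Bᵀ c) = 0`.
[cite: BorodinVonzurgathenHopcroft1982, §4 p0012:L46–66 and §5 p0026:L34–37; KumarVolk2022, §6 (proof of Cor. 1.3, "small space algorithm for linear algebra")] -/
theorem exists_gram_kernelVector [Nonempty n] (A : Matrix m n S) {v : n → S}
    (hv : v ≠ 0) (hAv : A *ᵥ v = 0) :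
    (∃ c : n, (charpolyKernelMatrix (Aᵀ * A))ᵀ c ≠ 0) ∧
      ∀ c : n, A *ᵥ ((charpolyKernelMatrix (Aᵀ * A))ᵀ c) = 0 := by
  have hB : (Aᵀ * A).det = 0 := det_gram_eq_zero A hv hAv
  exact ⟨exists_charpolyKernelMatrix_col_ne_zero _ hB, fun c =>
    mulVec_eq_zero_of_gram_mulVec_eq_zero A _ (mulVec_charpolyKernelMatrix_col _ hB c)⟩

/-- ★ **The canonical kernel vector of a rectangular system**: if `A` (ordered domain, e.g. `ℤ`) has
a nonzero kernel vector then `v := charpolyKernelVector (AᵀA)` — the least nonzero column of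
`q_B(B)·B^{j₀−1}`, `B = AᵀA` — satisfies `v ≠ 0` and `A v = 0`.
[cite: BorodinVonzurgathenHopcroft1982, §4 p0012:L46–66 and §5 p0026:L34–37; KumarVolk2022, §6 (proof of Cor. 1.3, "small space algorithm for linear algebra")] -/
theorem charpolyKernelVector_gram_spec [LinearOrder n] [Nonempty n] (A : Matrix m n S) {v : n → S}
    (hv : v ≠ 0) (hAv : A *ᵥ v = 0) :
    charpolyKernelVector (Aᵀ * A) ≠ 0 ∧ A *ᵥ charpolyKernelVector (Aᵀ * A) = 0 := by
  have hB : (Aᵀ * A).det = 0 := det_gram_eq_zero A hv hAv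
  exact ⟨charpolyKernelVector_ne_zero _ hB,
    mulVec_eq_zero_of_gram_mulVec_eq_zero A _ (mulVec_charpolyKernelVector _ hB)⟩

end Gram

/-! ### Index arithmetic (the shape a transducer mirrors): `k_B` as a trailing degree, the
coefficients of `q_B` as shifted coefficients of `χ_B`, `q_B(B)` as an explicit sum, the least column -/

section IndexForm

/-- `k_B` is the number of vanishing low coefficients of `χ_B` (its trailing degree).
[cite: BorodinVonzurgathenHopcroft1982, §4 (p0012:L46–66: "rank_alg(A) = max{i : c_{n-i}(A) ≠ 0} = n − order of c(A)")] -/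
theorem charpolyZeroMult_eq_natTrailingDegree (B : Matrix n n R) :
    charpolyZeroMult B = B.charpoly.natTrailingDegree :=
  rootMultiplicity_eq_natTrailingDegree'

/-- The low coefficients vanish: `coeff χ_B i = 0` for `i < k_B`.
[cite: BorodinVonzurgathenHopcroft1982, §4 (p0012:L46–66)] -/
theorem coeff_charpoly_eq_zero_of_lt (B : Matrix n n R) {i : ℕ} (hi : i < charpolyZeroMult B) :
    B.charpoly.coeff i = 0 :=
  coeff_eq_zero_of_lt_natTrailingDegree (by rwa [← charpolyZeroMult_eq_natTrailingDegree])

/-- … and `coeff χ_B k_B ≠ 0`: so `k_B` is the LEAST index of a nonzero coefficient of `χ_B`.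
[cite: BorodinVonzurgathenHopcroft1982, §4 (p0012:L46–66)] -/
theorem coeff_charpoly_charpolyZeroMult_ne_zero [Nontrivial R] (B : Matrix n n R) :
    B.charpoly.coeff (charpolyZeroMult B) ≠ 0 := by
  rw [charpolyZeroMult_eq_natTrailingDegree]
  exact trailingCoeff_nonzero_iff_nonzero.2 B.charpoly_monic.ne_zero

/-- **The coefficients of `q_B` are the shifted coefficients of `χ_B`**:
`coeff q_B i = coeff χ_B (i + k_B)`. [cite: BorodinVonzurgathenHopcroft1982, §4 (p0012:L46–66)] -/
theorem coeff_charpolyUnitPart (B : Matrix n n R) (i : ℕ) :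
    (charpolyUnitPart B).coeff i = B.charpoly.coeff (i + charpolyZeroMult B) := by
  conv_rhs => rw [← X_pow_mul_charpolyUnitPart B]
  rw [map_zero, sub_zero, coeff_X_pow_mul]

/-- `deg q_B ≤ n`. [cite: BorodinVonzurgathenHopcroft1982, §4 (p0012:L46–66)] -/
theorem natDegree_charpolyUnitPart_le [Nontrivial R] (B : Matrix n n R) :
    (charpolyUnitPart B).natDegree ≤ Fintype.card n := by
  unfold charpolyUnitPart
  rw [natDegree_divByMonic _ ((monic_X_sub_C (0 : R)).pow _), Matrix.charpoly_natDegree_eq_dim]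
  exact Nat.sub_le _ _

/-- **`q_B(B)` as an explicit polynomial in `B`** over a fixed index range:
`q_B(B) = Σ_{i ≤ n} coeff χ_B (i + k_B) • B^i`. [cite: BorodinVonzurgathenHopcroft1982, §4 (p0012:L46–66)] -/
theorem aeval_charpolyUnitPart_eq_sum [Nontrivial R] (B : Matrix n n R) :
    aeval B (charpolyUnitPart B) =
      ∑ i ∈ Finset.range (Fintype.card n + 1), B.charpoly.coeff (i + charpolyZeroMult B) • B ^ i := by
  rw [aeval_eq_sum_range' (Nat.lt_succ_of_le (natDegree_charpolyUnitPart_le B)) B]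
  simp_rw [coeff_charpolyUnitPart]

/-- **The canonical kernel vector is the LEAST nonzero column** of `N_B` (singular `B`, domain):
there is an index `c` with `N_Bᵀ c ≠ 0`, all earlier columns zero, and `v_B = N_Bᵀ c`.
[cite: BorodinVonzurgathenHopcroft1982, §5 (p0026:L36–37 "NULLSPACE")] -/
theorem charpolyKernelVector_eq_least_col [IsDomain R] [Nonempty n] [LinearOrder n]
    (B : Matrix n n R) (hB : B.det = 0) :
    ∃ c : n, (charpolyKernelMatrix B)ᵀ c ≠ 0 ∧ (∀ c' < c, (charpolyKernelMatrix B)ᵀ c' = 0) ∧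
      charpolyKernelVector B = (charpolyKernelMatrix B)ᵀ c := by
  classical
  set s := Finset.univ.filter fun c => (charpolyKernelMatrix B)ᵀ c ≠ 0 with hs
  obtain ⟨c₀, hc₀⟩ := exists_charpolyKernelMatrix_col_ne_zero B hB
  have hne : s.Nonempty := ⟨c₀, Finset.mem_filter.2 ⟨Finset.mem_univ _, hc₀⟩⟩
  refine ⟨s.min' hne, (Finset.mem_filter.1 (Finset.min'_mem s hne)).2, fun c' hc' => ?_, ?_⟩
  · by_contra h
    exact (Finset.min'_le s c' (Finset.mem_filter.2 ⟨Finset.mem_univ _, h⟩)).not_gt hc'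
  · unfold charpolyKernelVector
    rw [dif_pos hne]

end IndexForm

end Literature.LinearAlgebra
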